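import Summits.BirchSwinnertonDyer.BirchSwinnertonDyer.Theses.InertBadSignedBranches
import Summits.BirchSwinnertonDyer.BirchSwinnertonDyer.Theses.BiquadraticEisensteinDescent
import Summits.BirchSwinnertonDyer.BirchSwinnertonDyer.Theorems.InertBadSignedBranchesInertBadAtThreeBedLinks
import Summits.BirchSwinnertonDyer.BirchSwinnertonDyer.Theorems.InertBadSignedBranchesInertBadAtThreeBedGlue
import Summits.BirchSwinnertonDyer.BirchSwinnertonDyer.Theorems.InertBadSignedBranchesInertBadAtThreeNonNullOddHeegner
import Summits.BirchSwinnertonDyer.BirchSwinnertonDyer.Theorems.InertBadSignedBranchesInertBadAtThreeBedManinIstar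
import Summits.BirchSwinnertonDyer.BirchSwinnertonDyer.Theorems.InertBadSignedBranchesInertBadAtThreeManinCells
import Summits.BirchSwinnertonDyer.BirchSwinnertonDyer.Theorems.InertBadSignedBranchesInertBadAtThreeManinOfKatoThree
import Summits.BirchSwinnertonDyer.BirchSwinnertonDyer.Theorems.InertBadSignedBranchesInertBadAtThreePointwiseKatoLever
import Summits.BirchSwinnertonDyer.BirchSwinnertonDyer.Theorems.InertBadSignedBranchesInertBadAtThreeManinOfNeronIntegralCMInert
import Literature.NumberTheory.QuadraticFields.ThreeTorsionMeanHeegner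
import HarnessLib

/-!
# Skeleton `bed_at_three` v6 for crux `InertBadAtThree` (stmt-BirchSwinnertonDyer-19225) — the TRANSFER line:
# route `BiquadraticEisensteinDescent`'s (BED, row 12) `p ≥ 5` Eisenstein-descent chain re-run AT `p = 3`

v6 (lead `bsd-line-ibd-p1` g6, 2026-08-28) — PUBLISHED FALLBACK, NOT registered: the skeleton of record on 19225 is now
`Lines/rubin_e1_inert_three.lean` v4 (sha16 d5de30f38debde80; quartic-cell stub `stub_neronIntegralThreeQuartic`, weaker than this file's
`stub_neronIntegralThreeCMInert` — `RubinE1InertThree.neronIntegralThreeQuartic_of_neronIntegralCMInert`). In this file the Kato stub is LOCALISED to the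
whole CM-inert class. v5's `stub_katoFactThreePolar` (= the named Literature
statement F-es-18 `kato_neron_isIntegral_twistedSymbolSum_of_additive_three_polar`, quantified over EVERY additive-at-3 curve with
irreducible `W[3]`; a derived reading of Kato, XL) is REPLACED by the strictly WEAKER stub `stub_neronIntegralThreeCMInert`
= F-es-18's body on the CM-INERT BAD-3 CLASS ONLY (globally minimal CM `V` with `3` inert in the CM field and bad at `3` — exactly
the instances the line consumes; spelled inline, tree constants only). This is sound because route ManinLocalTwoThree's lever uses
the fact only AT THE CURVE IN HAND: helper `Theorems/InertBadSignedBranchesInertBadAtThreePointwiseKatoLever.lean` (this lead) proves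
the POINTWISE lever `not_three_dvd_c_of_neronIntegralAt` UNCONDITIONALLY (generation E-es-19 = `shiftClassGenerationThree_holds`), and
`Theorems/InertBadSignedBranchesInertBadAtThreeManinOfNeronIntegralCMInert.lean` derives the line's `ManinAtThree` from the CM-inert
instances (`maninAtThree_of_cmFact` below) and the instances from F-es-18 (`neronIntegralThreeCMInert_of_katoFact`: one `_holds` of
F-es-18 still closes the stub, so the debt stays shared with crux 22968). The new stub has TWO independent roads: Kato's (P1)–(P5)
reading restricted to the class, or the CM-side road of crux idea card `Ideas/rubin-e1-inert-three.md` (bsd-idea-18 g6: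
Eisenstein–Kronecker numbers of the class-number-one CM field at division points of order divisible by the inert `3`, tame
Lagrange resolvent in the height-2 Lubin–Tate group; the finite `E₁`-formula is a tree theorem for `ℚ(i)`). STUBS v6 (3 sorries):
`stub_heartAtThree` (research, unchanged, W-19), `stub_neronIntegralThreeCMInert` (OPEN, L), `stub_printedInputsAtThree` (HELD,
unchanged). Composition `InertBadAtThree_of : PrintedInputsAtThree → NeronIntegralThreeCMInert → HeartAtThree →
InertBadSignedBranches.InertBadAtThree`. lean rc 0; sorries 3 = stubs. BSD is not proved by any of this; no crux is proved here.

v4 (lead `bsd-line-ibd-p1` g5, 2026-08-28): the MANIN STUB IS GONE. v3's `stub_maninAtThreeQuartic` (Manin `3 ∤ c` on the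
quartic cell `j = 1728`, Kodaira `III/III*` at `3`; booked «open, small, no source») is now the THEOREM
`maninAtThreeQuartic_of_katoFact`, from ONE named Literature statement ALREADY IN THE TREE:
`Literature.NumberTheory.EllipticCurves.kato_neron_isIntegral_twistedSymbolSum_of_additive_three_polar` (F-es-18 of cell
`pub/bsd-f2-manin`: Kato, Astérisque 295 (2004) (8.1.3) + Thm. 9.7 + Thm. 6.6 (1) read in Néron units at the additive prime `3`
through Kosters–Pannekoek's §3.3.1 receptacle, tame characters with `χ(3) ∉ {±1}`; a DERIVED READING of printed theorems —
statement-only, size XL, refuter-audited ×2 — NOT verbatim print), through route `ManinLocalTwoThree`'s `p = 3` Euler-system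
lever `Theorems.ManinLocalTwoThree.katoShiftTwistManinThree_of_katoFact` (Manin `3 ∤ c` at every lattice-optimal datum with
`9 ∣ N` and `W[3]` IRREDUCIBLE; its generation input E-es-19 is the tree theorem `shiftClassGenerationThree_holds`): at a
CM-inert `3`, `W[3]` is irreducible (`X12.irr_of_cmInert`) and a bad `3` is additive (`9 ∣ N_W`), helper
`Theorems/InertBadSignedBranchesInertBadAtThreeManinOfKatoThree.lean` (p620851, `--supports 19225 --as helper`). The named
statement becomes the stub `stub_katoFactThreePolar` — the SAME statement route `ManinLocalTwoThree`'s crux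
`ManinPrimeToThreeAtNine` (stmt-22968, line `kato_shift_three`) carries as its registered stub: shared debt, one discharge closes
both. STUBS v4 (3 sorries): `stub_heartAtThree` (research, unchanged; promote-stub g4), `stub_katoFactThreePolar` (named
Literature statement, XL), `stub_printedInputsAtThree` (HELD print conjunction, unchanged). Composition
`InertBadAtThree_of : PrintedInputsAtThree → kato…three_polar → HeartAtThree → InertBadSignedBranches.InertBadAtThree`.
lean rc 0; sorries 3 = stubs. v5 (same session): since `maninAtThree_of_katoFact` yields the WHOLE Manin input R₃ from
F-es-18, the composition no longer routes through the printed Manin facts of BED's R₅₇ split — `PrintedInputsAtThree` v5 DROPS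
its last three conjuncts (`MazurManinOdd`, `AbbesUllmoManinGood`, `CesnaviciusManinTwo`): v5 = v1's seven inputs ∧ the BV mean. The
held print of the line is thereby MINIMAL for its composition (`InertBadAtThree_of hI hK hE := inertBadAtThree_of_links hI.1
(C⁺odd from hI.2) (maninAtThree_of_katoFact hK) hE`). BSD is not proved by any of this; no crux is proved by this file. The v3
docstring follows.

v1: ideator `bsd-idea-18` g3 (lens = transfer; sha16 fb44234c142785a0, 608 l., 4 stubs; critic idea-crit-15
VERDICT #11 PASS-WITH-PRICE). v2/v3 (this file; v2 f4bd1002dc183cae had the coarse off-`I₀*` Manin residual, v3 adopts width seat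
bsd-wall-cm-bed-w2 g7's QUARTIC residual text verbatim, p617415 ✓): lead `bsd-line-ibd-p1` g4 (2026-08-28) — RESHAPE after landing
the line's landable content as Theorems helpers (`--supports 19225`):

* `Theorems/InertBadSignedBranchesInertBadAtThreeBedLinks.lean` (p616183 ✓) — the PORTED LINKS, sorry-free:
  control C″ at `𝔭′ ∣ 3` of `K′` (`c10B_three`, `controlAtThree`), the ♭-frame at any odd bad `p`
  (`frame_value_of_lzz_odd`, `frameAtThree` = `FrameAtThree` below, modulo Hsieh Thm A + LZZ by name), the odd
  density-one switch, the halves algebra `key3`;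
* `Theorems/InertBadSignedBranchesInertBadAtThreeBedGlue.lean` (p617011) — the COMPOSITION `inertBadAtThree_of_links :
  (printed inputs) → C⁺odd(N,3) → Manin@3 → Heart@3 → InertBadSignedBranches.InertBadAtThree` (BED's `closes` at
  `p = 3` through `X12.bsdp_of_classX12_of_bad_odd_of_indexLowerBoundAt`), statements by value;
* `Theorems/InertBadSignedBranchesInertBadAtThreeNonNullOddHeegner.lean` (p615210 ✓) — v1's stub 3 C⁺odd(N,3)
  `NonNullOddIndivisibleHeegnerThree` PROVED from the Davenport–Heilbronn mean with Heegner local conditions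
  (Bhargava–Varma 2016 Cor. 4 (a), typed as the named fact
  `Literature/NumberTheory/QuadraticFields/ThreeTorsionMeanHeegner.lean` `bv_threeTorsion_mean_imaginary_heegnerOdd`,
  p615601 ✓ reviewed): progression `D ≡ 1 (mod 8N)` ⊂ family, positive density (tree's squarefree AP count),
  `#Cl₃ ∈ {1} ∪ 3ℕ`;
* `Theorems/InertBadSignedBranchesInertBadAtThreeBedManinIstar.lean` (p616527 ✓) — v1's stub R₃ `ManinAtThree`
  SPLIT along the signed local type at `3`: the `I₀*` cell is CLOSED in the tree (Stevens (5.2) via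
  `WAll.maninDatum_of_kodairaSymbolAt_eq_Istar`, modulo Mazur 1978 / Abbes–Ullmo 1996 / Česnavičius 2018 /
  modularity BY NAME = BED's print items `MazurManinOdd`, `AbbesUllmoManinGood`, `CesnaviciusManinTwo`,
  `ModularityNewformExists`); residual = the off-`I₀*` cell, which `Theorems/InertBadSignedBranchesInertBadAtThreeManinCells.lean`
  (bed-w2 g7, p617415 ✓; Kodaira classification at a CM-inert bad `3`, `X12.InertBadLocalTypesThree`) identifies EXACTLY with the
  QUARTIC cell `j = 1728 ∧ type ∈ {III, III*}` at the place over `3` (`not_hasSignedLocalType_IstarZero_iff_quartic`; K8's HELD child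
  19657's corner) — `ManinAtThreeQuartic` below, = the `hRes` binder of `maninAtThree_of_facts_of_quarticResidual` verbatim.

STUBS v3 (3 sorries; v1 had 4): `stub_heartAtThree` (E_K′@3 — UNCHANGED text, the research content; `p = 3`
is excluded in print three times: Hsieh JAMS 27 (2014) L.7.15 / P.7.16 + hyp (1) `p ∤ 3·h⁻·D_F`, and the 2025
repair arXiv:2508.19706 Thm 1.4/1.6 `(ℓ, 6𝔭D_F) = 1`; critic P1: blocked-like-k8 for provers),
`stub_maninAtThreeQuartic` (NEW, smaller than v1's `stub_maninAtThree`: Manin `3 ∤ c` on the quartic cell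
`j = 1728`, type `III`/`III*` at `3` only; no source — Edixhoven 1991 needs `p > 7`, BED's `p ∈ {5,7}` twin is closed modulo Kato's Néron integrality
typed for `p ≥ 5`), `stub_printedInputsAtThree` (HELD print conjunction; v2 = v1's seven inputs ∧ the BV mean ∧
the three Manin print facts — every conjunct a published theorem or BED's own held input; never a worker target).
v1's `stub_nonNullOddIndivisibleHeegnerThree` is now the THEOREM `nonNullOddIndivisibleHeegnerThree_of_printedInputs`;
v1's `stub_maninAtThree` the THEOREM `maninAtThree_of_printedInputs_of_quartic`.

Composition: `InertBadAtThree_of : PrintedInputsAtThree → ManinAtThreeQuartic → HeartAtThree →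
InertBadSignedBranches.InertBadAtThree` (one line over the glue helper); `InertBadAtThree_bed_of` concludes BED's
copy; `InertBadAtThree_proof` the crux BY NAME from the three stubs. lean rc 0; sorries 3 = stubs. The v1 module
docstring (transfer rationale, where `p ≠ 3` enters Hsieh, barrier story) is kept verbatim below. BSD is not
proved by any of this; no crux is proved by this file.

## v1 module docstring (ideator bsd-idea-18 g3), verbatim


# Skeleton `bed_at_three` for crux `InertBadAtThree` (stmt-BirchSwinnertonDyer-19225) — the TRANSFER line:
# route `BiquadraticEisensteinDescent`'s (BED, row 12) `p ≥ 5` Eisenstein-descent chain re-run AT `p = 3`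

Ideator `bsd-idea-18` g3 (lens = transfer, D-0145/D-0154 KEY (146) row 12; W-71: no route birth; this is a
crux LINE on the shared item, typed for BOTH sharing routes' decls). BSD is not proved by any of this; no crux
is proved by this file.

THE TRANSFER. BED's `closes` (rev 17) proves `BSD(E,p)` for a CM curve of analytic rank one with bad,
CM-inert `p ≥ 5` by descending in an AUXILIARY imaginary quadratic Heegner field `K′` (every `ℓ ∣ N_E` split,
so `p` SPLIT in `K′` although inert in the CM field `K`): ♭-frame (Hsieh Thm A + Liu–Zhang–Zhang additive
`p`-adic Waldspurger) · anticyclotomic control at the other prime `𝔭′` (JSW 3.3.1 shape, PROVED in tree) ·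
Eisenstein divisibility at `T = 0` (crux E_K′, OPEN) · halves algebra · STEP L ⇒ BSD_p (X12, PROVED).
At `p = 3` the item is routed elsewhere (k8 split: two children each needing a NEW `p`-adic Gross–Zagier
formula at a potentially-supersingular prime — no engine in print). This skeleton records that the BED
chain itself PORTS to `p = 3`, type-blind (it never looks at the Kodaira type at 3, so it covers both k8
children at once), and isolates exactly what does not port:
* PORTS VERBATIM (the tree proofs use `5 ≤ p` only as `p ≠ 2`): control C″ (`…ControlCMInertBadKPrimeOtherBody.c10B/c10A`
  — re-proved below at `p = 3`, `controlAtThree`, no sorry); the supply switch (`…DensityOneSwitch`, any `p`; re-proved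
  below with the extra conjunct `Odd d`, `exists_heegnerField_oddTwist_L_one_ne_zero_of_nonNull`, no sorry); STEP L ⇒ BSD₃
  (`X12.bsdp_of_classX12_of_bad_odd_of_indexLowerBoundAt`, needs `Odd d_K′`, `3 ∤ Tam(E)` =
  `X12.not_three_dvd_tamagawaProduct_of_hasCM_of_not_cmRamified_three`, `3 ∤ w_K′` = `X12.not_dvd_torsionOrder_of_four_lt_natAbs_discr`);
  the Tamagawa identities at a Heegner field for every prime (`X11b.…_of_heegner_prime`); the halves algebra (`key3` below).
* PORTED HERE (no sorry): the ♭-frame W″ (`frame_value_of_lzz_odd` = `…KatzWaldspurgerFrameCMInertBadFlatBody.frame_value_of_lzz`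
  with `(hp5 : 5 ≤ p)` weakened to `(hp2 : p ≠ 2)` — the tree proof used `hp5` only through `p ≠ 2`; the LZZ fact
  `LiuZhangZhang2018.thm151_thm153_modularCurve_heegnerVector_additive` and Hsieh's Thm A fact are typed for `p ≠ 2`;
  `frameAtThree : FrameAtThree` is the `p = 3` instance).
* IS PRINT, UNTYPED (stub `stub_nonNullOddIndivisibleHeegnerThree` = C⁺odd(N,3)): Davenport–Heilbronn with finitely many
  local conditions (Nakagawa–Horie 1988 Thm 1; Bhargava–Shankar–Tsimerman 2013 Thm 2; Bhargava–Varma 2016 Thm 2): the mean of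
  `#Cl_K[3]` over imaginary quadratic `K` in an acceptable box is 2, so the proportion with `3 ∤ h_K` has liminf ≥ 1/2 > 0 —
  non-nullity, exactly the currency of the switch (no limit-existence is claimed). At `p ≥ 5` the same statement is BED's
  open crux C⁺ (item 21381's line size_tail); at `p = 3` it is a theorem in print: THIS is why the supply transfers down.
* IS THE RESEARCH CONTENT (stub `stub_heartAtThree` = E_K′@3): Hsieh JAMS 27 (2014) Thm 2 / Cor 2 hypothesis (1)
  `p ∤ 3·h⁻_𝒦·D_F` contains the literal factor 3. First-hand location of where `p ≠ 3` is consumed: Lemma 7.15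
  (p. 48, «suppose p ∤ 6·D_F», existence of the auxiliary self-dual character with root number +1, p > 3 unramified)
  and the proof of Prop 7.16 (p. 49 l. 1, residual non-self-duality «χ unramified at p > 3» ⇒ Hyp 7.12 via Hsieh 2012
  Cor 6.5/Thm 6.8); hypothesis (2) (`a ≡ 2 mod p−1` exclusions) is vacuous at `p = 3`. So E_K′@3 = BED's heart with ONE
  extra named input: a replacement for Lemma 7.15/Prop 7.16 at `p = 3` for `𝒦 = K·K′` biquadratic (3 split in `K′`,
  inert in `K`; note `μ₃ ⊄ 𝒦` automatically, since `ℚ(√−3)` is neither `K` (3 inert) nor `K′` (3 split) nor the real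
  quadratic subfield — the `j = 0` family is CM-RAMIFIED at 3 and outside this crux). Why it might fail: the Eisenstein
  congruence mod 3 on U(2,1) may genuinely need `p > 3` (Hsieh invokes [Hsi12, Cor 6.5/Thm 6.8] for `p > 3`; neatness /
  small-prime torsion in the level structure), and E_K′ at `p ≥ 5` (BED's rank-2 crux) is itself open.
* Manin at 3 (stub `stub_maninAtThree` = R₃, the `p = 3` twin of BED's R₅₇ `ManinDatumFiveSevenCMInert`): the `I_n*` cell
  is in tree (`WAll.AltClosersManinCells.maninDatum_of_kodairaSymbolAt_eq_Istar`, `p ≠ 2`); residual = types III/III* at 3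
  (the `j = 1728` quartic twists — exactly k8's second child's curves; CM-inert at 3 forces `j ≠ 0`), where `3 ∣ c` is not
  excluded in print for non-semistable optimal curves (Edixhoven 1991 covers `p > 7`; Česnavičius 2018 the semistable primes).
Composition `InertBadAtThree_of : PrintedInputsAtThree → NonNullOddIndivisibleHeegnerThree → ManinAtThree → HeartAtThree →
InertBadSignedBranches.InertBadAtThree` = BED's `closes` specialised to `p = 3` with the `p = 3` STEP-L lemma (kernel-checked,
no sorry outside `stub_*`); `InertBadAtThree_bed_of` concludes BED's copy of the decl. Answer to the lead note
LEAD-NOTE-ibd-p1-g2 («BED's lever does not reach p = 3: 3 ∣ 3·h⁻·D_F»): correct for Hsieh's theorem AS PRINTED; this line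
makes that single printed hypothesis the named stub and shows every OTHER link of the lever reaches 3 in the tree.
lean rc 0; sorries 4 = stubs (heart, manin, C⁺odd@3, printed inputs); frame / control / switch / halves algebra
proved in this file, STEP L ⇒ BSD₃ and the Tamagawa / torsion side conditions from the tree. BSD is not proved by any of this.


-/

set_option linter.dupNamespace false
set_option autoImplicit false

noncomputable section

open scoped Classical

open WeierstrassCurve Literature.NumberTheory.EllipticCurves Literature.NumberTheory.EllipticCurves.Rank1Residual

namespace Summit.BirchSwinnertonDyer.BirchSwinnertonDyer.Cruxes.InertBadAtThree.BedAtThree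

open Summit.BirchSwinnertonDyer.BirchSwinnertonDyer.Theses
open Summit.BirchSwinnertonDyer.BirchSwinnertonDyer.Theorems

/-! ## The statements of the line (BED item texts with `5 ≤ p` ↦ `p = 3`; fully qualified) -/

/-- E_K′@3 — BED item `EisensteinDivisibilityCMInertBadFlatAtOneKPrime` (stmt …-E_K′, rank 2 of BED) with `5 ≤ p`
replaced by `p = 3`, NOTHING else changed: granted Hsieh's `μ = 0` fact (Thm B, any level), at a CM-inert bad `p = 3`,
a Heegner field `K′` with `|d_{K′}| > 4`, `3 ∤ h_{K′}`, `L(E^{K′},1) ≠ 0`, an anticyclotomic `(κ, γ)`, a degree-one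
`𝔭 ∋ 3` and the OTHER prime `𝔭′ ∋ 3` with `X_ac^{𝔭′}` torsion, and ANY ♭-frame `(f, ι′, Ω, Ω_p, Q)`:
`char(X_ac^{𝔭′})(0) ∣ Q(0)` in `𝓞_{ℂ_3}`. The research content of the line (see module docstring: Hsieh 2014
Lemma 7.15 / Prop 7.16 are the two places `p ≠ 3` is used). -/
def HeartAtThree : Prop :=
  Literature.NumberTheory.EllipticCurves.Hsieh2014.thmB_exists_isHsiehLFunction_coeff_norm_eq_one_unrPeriod_anyLevel → ∀ (W : WeierstrassCurve ℚ) [W.IsElliptic] [W.IsGloballyMinimal] (p : ℕ) [Fact p.Prime] [NeZero (W.conductorNorm ℤ)] (K : Type) [Field K] [NumberField K], W.HasCM → W.analyticRank = 1 → p = 3 → Literature.NumberTheory.EllipticCurves.Rank1Residual.CMInert W p → ¬ Literature.NumberTheory.EllipticCurves.Rank1Residual.Good W p → Literature.NumberTheory.EllipticCurves.IsImaginaryQuadratic K → Literature.NumberTheory.EllipticCurves.SatisfiesHeegnerHypothesis (W.conductorNorm ℤ) K → 4 < (NumberField.discr K).natAbs → ¬ p ∣ NumberField.classNumber K → (W.quadraticTwist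 (NumberField.discr K : ℚ)).entireLFunction 1 ≠ 0 → ∀ (κ : Literature.NumberTheory.EllipticCurves.ZpExtension K p), κ.IsAnticyclotomic → ∀ (γ : Field.absoluteGaloisGroup K) [Fact (κ.IsTopGenerator γ)] (𝔭 : IsDedekindDomain.HeightOneSpectrum (NumberField.RingOfIntegers K)), ((p : ℕ) : NumberField.RingOfIntegers K) ∈ 𝔭.asIdeal → 𝔭.asIdeal.ramificationIdx (NumberField.RingOfIntegers ℚ) = 1 → 𝔭.asIdeal.inertiaDeg (NumberField.RingOfIntegers ℚ) = 1 → ∀ (𝔭' : IsDedekindDomain.HeightOneSpectrum (NumberField.RingOfIntegers K)), ((p : ℕ) : NumberField.RingOfIntegers K) ∈ 𝔭'.asIdeal → 𝔭' ≠ 𝔭 → Module.IsTorsion (Literature.NumberTheory.EllipticCurves.IwasawaAlgebra p) (Summit.BirchSwinnertonDyer.Rank1Residual.X11b.AcSelmer.XAc (W.baseChange K) p κ 𝔭' ∅ γ) → ∀ (f : CuspForm (CongruenceSubgroup.Gamma0 (W.conductorNorm ℤ)) 2), Literature.NumberTheory.EllipticCurves.ModularForms.IsNewformOf W f → ∀ (ι'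 : PadicAlgCl p ≃+* ℂ), (∀ (w : NumberField.InfinitePlace K) (k : NumberField.RingOfIntegers K), k ∈ 𝔭.asIdeal ↔ ‖ι'.symm (w.embedding (k : K))‖ < 1) → ∀ (ΩK : ℂ) (Ωp : (Literature.NumberTheory.EllipticCurves.unrIntegers p)ˣ) (Q : PowerSeries (PadicComplexInt p)), ΩK ≠ 0 → Summit.BirchSwinnertonDyer.Rank1Residual.X11b.R1.IsBDPLFunctionInt p ι' 𝔭 κ γ f ΩK ((Ωp : Literature.NumberTheory.EllipticCurves.unrIntegers p) : (PadicComplex p)) Q → (Summit.BirchSwinnertonDyer.Rank1Residual.X11b.AcSelmer.XAc.charIdeal (W.baseChange K) p κ 𝔭' ∅ γ).map ((Summit.BirchSwinnertonDyer.Rank1Residual.X11b.R1.toCpInt p).comp (PowerSeries.constantCoeff : Literature.NumberTheory.EllipticCurves.IwasawaAlgebra p →+* ℤ_[p])) ≤ Ideal.span {PowerSeries.constantCoeff Q}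

/-- W″@3 — BED item `KatzWaldspurgerFrameCMInertBadFlatKPrimeOfLZZ` (rank 3 of BED, whose `p ≥ 5` body `w10` is PROVED
in `…KatzWaldspurgerFrameCMInertBadFlatKPrimeBody`) with `5 ≤ p` replaced by `p = 3`: granted Hsieh Thm A (any level)
and the Liu–Zhang–Zhang additive `p`-adic Waldspurger fact, at every Heegner datum `(Dt, H, ι, P)` with `3 ∤ c(Dt)` there
is a ♭-frame whose value at `𝟙` is `u·(log_ω P)²`, `‖u‖ ≤ 1`. PROVED below (`frameAtThree`), not a stub. -/
def FrameAtThree : Prop :=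
  Literature.NumberTheory.EllipticCurves.Hsieh2014.thmA_exists_isHsiehLFunction_unrPeriod_anyLevel → Literature.NumberTheory.EllipticCurves.LiuZhangZhang2018.thm151_thm153_modularCurve_heegnerVector_additive → ∀ (W : WeierstrassCurve ℚ) [W.IsElliptic] [W.IsGloballyMinimal] (p : ℕ) [Fact p.Prime] [NeZero (W.conductorNorm ℤ)] (K : Type) [Field K] [NumberField K] (Dt : Literature.NumberTheory.EllipticCurves.ModularForms.ModularParametrizationData W (W.conductorNorm ℤ)) (H : Literature.NumberTheory.EllipticCurves.HeegnerDatum (W.conductorNorm ℤ) (NumberField.discr K)) (ι : K →+* ℂ) (P : (W.baseChange K).toAffine.Point), W.HasCM → W.analyticRank = 1 → p = 3 → Literature.NumberTheory.EllipticCurves.Rank1Residual.CMInert W p → ¬ Literature.NumberTheory.EllipticCurves.Rank1Residual.Good W p → Literature.NumberTheory.EllipticCurves.IsImaginaryQuadratic K → Literature.NumberTheory.EllipticCurves.SatisfiesHeegnerHypothesis (W.conductorNorm ℤ) K → 4 < (NumberField.discr K).natAbs → WeierstrassCurve.Affine.Point.map ι.toRatAlgHom P = Literature.NumberTheory.EllipticCurves.ModularForms.heegnerPointComplex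 Dt H → ¬ (p : ℤ) ∣ Dt.c → (W.quadraticTwist (NumberField.discr K : ℚ)).entireLFunction 1 ≠ 0 → ∀ (κ : Literature.NumberTheory.EllipticCurves.ZpExtension K p), κ.IsAnticyclotomic → ∀ (γ : Field.absoluteGaloisGroup K) [Fact (κ.IsTopGenerator γ)] (𝔭 : IsDedekindDomain.HeightOneSpectrum (NumberField.RingOfIntegers K)) (h𝔭 : ((p : ℕ) : NumberField.RingOfIntegers K) ∈ 𝔭.asIdeal) (he : 𝔭.asIdeal.ramificationIdx (NumberField.RingOfIntegers ℚ) = 1) (hf : 𝔭.asIdeal.inertiaDeg (NumberField.RingOfIntegers ℚ) = 1), ∃ (f : CuspForm (CongruenceSubgroup.Gamma0 (W.conductorNorm ℤ)) 2), Literature.NumberTheory.EllipticCurves.ModularForms.IsNewformOf W f ∧ ∃ ι' : PadicAlgCl p ≃+* ℂ, (∀ (w : NumberField.InfinitePlace K) (k : NumberField.RingOfIntegers K), k ∈ 𝔭.asIdeal ↔ ‖ι'.symm (w.embedding (k : K))‖ < 1) ∧ ∃ (ΩK : ℂ) (Ωp : (Literature.NumberTheory.EllipticCurves.unrIntegers p)ˣ)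 (Q : PowerSeries (PadicComplexInt p)), ΩK ≠ 0 ∧ Summit.BirchSwinnertonDyer.Rank1Residual.X11b.R1.IsBDPLFunctionInt p ι' 𝔭 κ γ f ΩK ((Ωp : Literature.NumberTheory.EllipticCurves.unrIntegers p) : (PadicComplex p)) Q ∧ ∃ u : PadicComplex p, ‖u‖ ≤ 1 ∧ Literature.NumberTheory.EllipticCurves.IntSeries.HasValueAt Q 0 (u * (algebraMap (Padic p) (PadicComplex p) (Summit.BirchSwinnertonDyer.Rank1Residual.X11b.Halves.logOmega W p (Summit.BirchSwinnertonDyer.Rank1Residual.X11b.embAt K p 𝔭 h𝔭 he hf) P)) ^ 2)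

/-- R₃ — BED item `ManinDatumFiveSevenCMInert` (R₅₇) with `(p = 5 ∨ p = 7)` replaced by `p = 3`: for an optimal
(lattice-unscaled) parametrisation datum of a CM curve of analytic rank one with CM-inert bad `3`, `3 ∤ c(Dt)`. The `I_n*`
cell is in tree (`WAll.AltClosersManinCells.maninDatum_of_kodairaSymbolAt_eq_Istar`, any `p ≠ 2`); the residual cells are
the Kodaira types III / III* at 3 (the `j = 1728` quartic twists; `j = 0` is CM-ramified at 3, hence excluded). -/
def ManinAtThree : Prop :=
  ∀ (W : WeierstrassCurve ℚ) [W.IsElliptic] [W.IsGloballyMinimal] [NeZero (W.conductorNorm ℤ)] (p : ℕ) [Fact p.Prime] (D : Literature.NumberTheory.EllipticCurves.ModularForms.ModularParametrizationData W (W.conductorNorm ℤ)), W.HasCM → W.analyticRank = 1 → p = 3 → Literature.NumberTheory.EllipticCurves.Rank1Residual.CMInert W p → ¬ Literature.NumberTheory.EllipticCurves.Rank1Residual.Good W p → (∀ z ∈ D.L.lattice, ∃ w ∈ Literature.NumberTheory.EllipticCurves.ModularForms.periodLattice D.f, z = D.c * w) → ¬ (p : ℤ) ∣ D.c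

/-- R₃ on the QUARTIC cell — the v3 RESIDUAL of `ManinAtThree`: the same conclusion for the pairs with `j(W) = 1728` and
Kodaira type `III` or `III*` at the place `v` of `ℤ` over `3` (the quartic twists `y² = x³ + a x`, `v₃(a)` odd; CM by `ℤ[i]`, `3`
inert). For a CM-inert bad `3` this is EXACTLY the off-`I₀*` cell (`…ManinCells.not_hasSignedLocalType_IstarZero_iff_quartic`, bed-w2
g7, p617415), i.e. K8's held child `InertBadAtThreeOffIstarZero` (stmt-19657)'s corner; the `I₀*` cell is closed in the tree
(`…BedManinIstar.not_dvd_c_of_hasSignedLocalType_Istar`). Text = the `hRes` binder of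
`InertBadSignedBranchesInertBadAtThreeManinCells.maninAtThree_of_facts_of_quarticResidual`, fully qualified. v3: «no source»
(Edixhoven 1991 Thm 3: additive `p ≥ 11`; Česnavičius 2018 / Česnavičius–Neururer–Saha 2024: semistable primes / `v₃(c) ≤ v₃(deg φ)`).
v4: a THEOREM modulo Kato's `p = 3` statement (`maninAtThreeQuartic_of_katoFact` below) — the CM-inert cell lies in the
`W[3]`-IRREDUCIBLE locus of route `ManinLocalTwoThree`'s `p = 3` lever. -/
def ManinAtThreeQuartic : Prop :=
  ∀ (W : WeierstrassCurve ℚ) [W.IsElliptic] [W.IsGloballyMinimal] [NeZero (W.conductorNorm ℤ)] (p : ℕ) [Fact p.Prime] (D : Literature.NumberTheory.EllipticCurves.ModularForms.ModularParametrizationData W (W.conductorNorm ℤ)) (v : IsDedekindDomain.HeightOneSpectrum ℤ), Rat.HeightOneSpectrum.natGenerator v = p → W.HasCM → W.analyticRank = 1 → p = 3 → Literature.NumberTheory.EllipticCurves.Rank1Residual.CMInert W p → ¬ Literature.NumberTheory.EllipticCurves.Rank1Residual.Good W p → (∀ z ∈ D.L.lattice, ∃ w ∈ Literature.NumberTheory.EllipticCurves.ModularForms.periodLattice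 D.f, z = D.c * w) → (W.j = 1728 ∧ (W.kodairaSymbolAt v = Literature.NumberTheory.DiophantineGeometry.KodairaSymbol.III ∨ W.kodairaSymbolAt v = Literature.NumberTheory.DiophantineGeometry.KodairaSymbol.IIIstar)) → ¬ (p : ℤ) ∣ D.c

/-- C⁺_CM (v6) — F-es-18's conclusion on the CM-INERT BAD-3 CLASS ONLY: for every globally minimal CM `V` with `3` inert in
the CM field and bad at `3` (so additive at `3`, `9 ∣ N_V`, `V[3]` irreducible), its newform `f` at any level `N`, every primitive
`χ` mod `m`, `(m, 3N) = 1`, `χ ≠ 1`, `3 ∤ ord χ`, `χ(3) ∉ {1, −1}`: the symmetrised twisted value is `3`-integral against the NÉRON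
periods of `V` (body VERBATIM = `kato_neron_isIntegral_twistedSymbolSum_of_additive_three_polar` after its `V` binders). Strictly
weaker than F-es-18; the line consumes nothing more (`maninAtThree_of_cmFact`). OPEN; two roads (module docstring v6). -/
def NeronIntegralThreeCMInert : Prop :=
  ∀ (V : WeierstrassCurve ℚ) [V.IsElliptic] [V.IsGloballyMinimal],
    V.HasCM → CMInert V 3 → ¬ Good V 3 →
    ∀ {N : ℕ} [NeZero N]
      (f : CuspForm (CongruenceSubgroup.Gamma0 N) 2) (_ : Literature.NumberTheory.EllipticCurves.ModularForms.IsNewformOf V f)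
      (_ : ¬ V.HasGoodReductionAtPrime 3) (_ : ¬ V.HasMultiplicativeReductionAtPrime 3)
      (_ : V.HasIrreducibleModPGaloisRep 3) (m : ℕ) [NeZero m] (_ : m.Coprime (3 * N))
      (χ : DirichletCharacter ℂ m) (_ : χ.IsPrimitive) (_ : χ ≠ 1) (_ : ¬ 3 ∣ orderOf χ)
      (_ : χ (3 : ZMod m) ≠ 1) (_ : χ (3 : ZMod m) ≠ -1) (ϖ : ℚ) (r : ℂ),
      (χ.Even → (ϖ : ℝ) * V.realPeriodRat = Literature.NumberTheory.EllipticCurves.ModularForms.plusPeriod f →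
        (∏ ℓ ∈ N.primeFactors with ¬ ℓ ^ 2 ∣ N,
            (((ℓ : ℂ) - (V.LFunction ℓ : ℂ) * χ (ℓ : ZMod m)) *
              ((ℓ : ℂ) - (V.LFunction ℓ : ℂ) * (χ (ℓ : ZMod m))⁻¹))) *
            Literature.NumberTheory.EllipticCurves.ModularForms.twistedSymbolSum f χ =
          r * (Literature.NumberTheory.EllipticCurves.ModularForms.plusPeriod f : ℂ) →
        ∃ s : ℕ, ¬ 3 ∣ s ∧ IsIntegral ℤ ((s : ℂ) * ϖ * r)) ∧
      (χ.Odd → (ϖ : ℝ) * V.imaginaryPeriodRat = Literature.NumberTheory.EllipticCurves.ModularForms.minusPeriod f →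
        (∏ ℓ ∈ N.primeFactors with ¬ ℓ ^ 2 ∣ N,
            (((ℓ : ℂ) - (V.LFunction ℓ : ℂ) * χ (ℓ : ZMod m)) *
              ((ℓ : ℂ) - (V.LFunction ℓ : ℂ) * (χ (ℓ : ZMod m))⁻¹))) *
            Literature.NumberTheory.EllipticCurves.ModularForms.twistedSymbolSum f χ =
          r * (Literature.NumberTheory.EllipticCurves.ModularForms.minusPeriod f : ℂ) * Complex.I →
        ∃ s : ℕ, ¬ 3 ∣ s ∧ IsIntegral ℤ ((s : ℂ) * ϖ * r))

/-- C⁺odd(N,3) — the `p = 3`, odd-discriminant twin of line size_tail's C⁺ (item 21381): for every level `N ≠ 0` the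
square-free `d` that are discriminants of imaginary quadratic `K` with `|d| > 4`, `d` odd, every `ℓ ∣ N` split in `K`
and `3 ∤ h_K` are NOT a null set (tree currency `twistDensity … 0`). IN PRINT (Davenport–Heilbronn with local
conditions: Nakagawa–Horie 1988 Thm 1, Bhargava–Shankar–Tsimerman 2013 Thm 2, Bhargava–Varma 2016): liminf of the
proportion with `3 ∤ h` in the box is `≥ 1/2`; the box has positive density among square-free integers. Untyped in
`Literature/` (a cite/definition request rides with the card). -/
def NonNullOddIndivisibleHeegnerThree : Prop :=
  ∀ (N : ℕ), N ≠ 0 → ¬ Literature.NumberTheory.EllipticCurves.twistDensity (fun d : ℤ ↦ ∃ (K : Type) (_ : Field K) (_ : NumberField K), Literature.NumberTheory.EllipticCurves.IsImaginaryQuadratic K ∧ NumberField.discr K = d ∧ 4 < d.natAbs ∧ Odd d ∧ Literature.NumberTheory.EllipticCurves.SatisfiesHeegnerHypothesis N K ∧ ¬ 3 ∣ NumberField.classNumber K) 0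

/-- The refereed / published inputs the chain consumes BY NAME (HELD as print; no research content). v2 =
(v1's seven: BED's `PublishedInputsBiquadratic` conjunction (GZ, Kolyvagin, Matar–Nekovář, GZK, modularity ×2,
Friedberg–Hoffstein, Rubin's BSD triple, Edixhoven, Deuring, Cassels), Hsieh 2014 Thm A and Thm B (any level),
Liu–Zhang–Zhang 2018, and the three inputs of the density-one switch (Burungale–Tian `p`-converse at 2 for CM
curves, Monsky parity, Smith's distribution)) ∧ the Davenport–Heilbronn mean with Heegner local conditions
(Bhargava–Varma 2016 Cor. 4 (a), `QuadraticFields.bv_threeTorsion_mean_imaginary_heegnerOdd`). v5 (lead g5): the three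
Manin print facts of BED's R₅₇ split (`MazurManinOdd`, `AbbesUllmoManinGood`, `CesnaviciusManinTwo`), conjuncts of v2–v4, are
DROPPED — the Manin input R₃ now comes entirely from Kato's `p = 3` statement (`maninAtThree_of_katoFact`). -/
def PrintedInputsAtThree : Prop :=
  (BiquadraticEisensteinDescent.PublishedInputsBiquadratic ∧ BiquadraticEisensteinDescent.HsiehAnyLevelInput ∧
    BiquadraticEisensteinDescent.HsiehMuInvariantInput ∧ BiquadraticEisensteinDescent.LiuZhangZhangAdditiveInput ∧
    Literature.NumberTheory.EllipticCurves.burungaleTian_analyticRank_eq_zero_of_selmerCorank_eq_zero_of_hasCM ∧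
    Literature.NumberTheory.EllipticCurves.monsky_selmerCorank_two_mod_two_eq ∧
    (∀ (W : WeierstrassCurve ℚ) [W.IsElliptic], W.HasCM → Literature.NumberTheory.EllipticCurves.smith_selmerCorank_density W)) ∧
    Literature.NumberTheory.QuadraticFields.bv_threeTorsion_mean_imaginary_heegnerOdd

/-! ## Registered stubs (v6: three — heart, the CM-inert instances of Kato's `p = 3` statement, printed inputs) -/

/-- STUB (rank 1, HARDEST, OPEN — the research content): E_K′@3, see `HeartAtThree`. Size XL; booked
blocked-like-k8 (critic idea-crit-15 VERDICT #11 P1). -/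
theorem stub_heartAtThree : HeartAtThree := by
  sorry

/-- STUB (rank 2, v6 — OPEN, size L; replaces v5's `stub_katoFactThreePolar`, which it WEAKENS): C⁺_CM `NeronIntegralThreeCMInert`
— the instances of F-es-18 `kato_neron_isIntegral_twistedSymbolSum_of_additive_three_polar` on the CM-inert bad-3 class only (the
curves the line feeds to the pointwise Kato lever). Roads: (a) Kato, Astérisque 295 (2004) (8.1.3) + Thm. 9.7 + Thm. 6.6 (1) in Néron
units through Kosters–Pannekoek §3.3.1, restricted to the class (= F-es-18 ⟹ this, `neronIntegralThreeCMInert_of_katoFact`); (b) the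
CM side — Hecke `L`-values of the class-number-one CM field as Eisenstein–Kronecker division values (tree theorem
`GaussianLattice.thetaLFunction_one_eq_sum_kroneckerE₁` for `ℚ(i)`), Shimura reciprocity, tame resolvent at the inert `3` (card
`rubin-e1-inert-three`). Signature = the body of `NeronIntegralThreeCMInert` VERBATIM (tree constants only, so a `Theorems/` closer can state
it). [cite: Kato2004Asterisque, (8.1.3) (p. 180), Thm. 9.7 (p. 189), Thm. 6.6 (1) (p. 163)]
[cite: KostersPannekoek2017, Thm. 1 (ii) and §3.3.1] [cite: Rubin1999LNM1716, Prop. 7.15, Thm. 7.17] -/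
theorem stub_neronIntegralThreeCMInert :
    ∀ (V : WeierstrassCurve ℚ) [V.IsElliptic] [V.IsGloballyMinimal],
      V.HasCM → CMInert V 3 → ¬ Good V 3 →
      ∀ {N : ℕ} [NeZero N]
        (f : CuspForm (CongruenceSubgroup.Gamma0 N) 2) (_ : Literature.NumberTheory.EllipticCurves.ModularForms.IsNewformOf V f)
        (_ : ¬ V.HasGoodReductionAtPrime 3) (_ : ¬ V.HasMultiplicativeReductionAtPrime 3)
        (_ : V.HasIrreducibleModPGaloisRep 3) (m : ℕ) [NeZero m] (_ : m.Coprime (3 * N))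
        (χ : DirichletCharacter ℂ m) (_ : χ.IsPrimitive) (_ : χ ≠ 1) (_ : ¬ 3 ∣ orderOf χ)
        (_ : χ (3 : ZMod m) ≠ 1) (_ : χ (3 : ZMod m) ≠ -1) (ϖ : ℚ) (r : ℂ),
        (χ.Even → (ϖ : ℝ) * V.realPeriodRat = Literature.NumberTheory.EllipticCurves.ModularForms.plusPeriod f →
          (∏ ℓ ∈ N.primeFactors with ¬ ℓ ^ 2 ∣ N,
              (((ℓ : ℂ) - (V.LFunction ℓ : ℂ) * χ (ℓ : ZMod m)) *
                ((ℓ : ℂ) - (V.LFunction ℓ : ℂ) * (χ (ℓ : ZMod m))⁻¹))) *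
              Literature.NumberTheory.EllipticCurves.ModularForms.twistedSymbolSum f χ =
            r * (Literature.NumberTheory.EllipticCurves.ModularForms.plusPeriod f : ℂ) →
          ∃ s : ℕ, ¬ 3 ∣ s ∧ IsIntegral ℤ ((s : ℂ) * ϖ * r)) ∧
        (χ.Odd → (ϖ : ℝ) * V.imaginaryPeriodRat = Literature.NumberTheory.EllipticCurves.ModularForms.minusPeriod f →
          (∏ ℓ ∈ N.primeFactors with ¬ ℓ ^ 2 ∣ N,
              (((ℓ : ℂ) - (V.LFunction ℓ : ℂ) * χ (ℓ : ZMod m)) *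
                ((ℓ : ℂ) - (V.LFunction ℓ : ℂ) * (χ (ℓ : ZMod m))⁻¹))) *
              Literature.NumberTheory.EllipticCurves.ModularForms.twistedSymbolSum f χ =
            r * (Literature.NumberTheory.EllipticCurves.ModularForms.minusPeriod f : ℂ) * Complex.I →
          ∃ s : ℕ, ¬ 3 ∣ s ∧ IsIntegral ℤ ((s : ℂ) * ϖ * r)) := by
  sorry

/-- STUB (HELD, print only — never a worker target): the named published inputs, see `PrintedInputsAtThree`. -/
theorem stub_printedInputsAtThree : PrintedInputsAtThree := by
  sorry

/-! ## v1 stubs that are now theorems, and the ported frame -/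

/-- **W″ at `p = 3` — `FrameAtThree` PROVED** (the links helper's `frameAtThree`, modulo its two named antecedents).
[cite: LiuZhangZhang2018, Thm 1.5.1 and Thm 1.5.3 (Duke Math. J. 167 pp. 748–749)] [cite: Hsieh2014, Thm. A p. 712 (Doc. Math. 19)] -/
theorem frameAtThree : FrameAtThree :=
  InertBadSignedBranchesInertBadAtThreeBedLinks.frameAtThree

/-- **v1's stub 3 C⁺odd(N,3) is a theorem from the printed inputs** (the BV mean conjunct, via p615210's
`nonNullOddIndivisibleHeegnerThree_of_mean`). [cite: BhargavaVarma2016, Cor. 4 (a)] -/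
theorem nonNullOddIndivisibleHeegnerThree_of_printedInputs (hI : PrintedInputsAtThree) :
    NonNullOddIndivisibleHeegnerThree :=
  InertBadSignedBranchesInertBadAtThreeNonNullOddHeegner.nonNullOddIndivisibleHeegnerThree_of_mean hI.2

/-- **v3's road to R₃, kept for the record (NOT used by the v5 composition)**: R₃ from the quartic residual and the three
printed Manin facts of BED's R₅₇ split + modularity (the `Iₙ*` pairs by the tree's Stevens lemma, the classification
`Iₙ* ∨ (j = 1728 ∧ III/III*)` at a CM-inert bad `3` by bed-w2 g7's p617415 `maninAtThree_of_facts_of_quarticResidual`).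
[cite: Stevens1989, Lemmas (5.2), (5.4)] [cite: Mazur1978, Cor. 4.1] [cite: SilvermanATAEC1994, IV.9.4, Table 4.1] -/
theorem maninAtThree_of_maninFacts_of_quartic (hM : BiquadraticEisensteinDescent.MazurManinOdd)
    (hAU : BiquadraticEisensteinDescent.AbbesUllmoManinGood) (hC2 : BiquadraticEisensteinDescent.CesnaviciusManinTwo)
    (hnf : Literature.NumberTheory.EllipticCurves.ModularForms.exists_isNewformOf)
    (hR : ManinAtThreeQuartic) : ManinAtThree :=
  InertBadSignedBranchesInertBadAtThreeManinCells.maninAtThree_of_facts_of_quarticResidual hM hAU hC2 hnf hR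

/-- **v3's stub `stub_maninAtThreeQuartic` is a theorem from Kato's `p = 3` statement** (helper p620851
`InertBadSignedBranchesInertBadAtThreeManinOfKatoThree.maninAtThreeQuartic_of_katoFactThreePolar`: route
`ManinLocalTwoThree`'s lever `katoShiftTwistManinThree_of_katoFact` on the `W[3]`-irreducible locus, `X12.irr_of_cmInert`,
`9 ∣ N_W` for a CM curve bad at `3`). CONDITIONAL on the named statement (v5's stub; in v6 it implies the stub, `neronIntegralThreeCMInert_of_katoFact`).
[cite: Kato2004Asterisque, (8.1.3) (p. 180), Thm. 9.7 (p. 189), Thm. 6.6 (1) (p. 163)] [cite: Mazur1978, §6 Prop. 6.3 (1) (p. 153)] -/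
theorem maninAtThreeQuartic_of_katoFact
    (hK : Literature.NumberTheory.EllipticCurves.kato_neron_isIntegral_twistedSymbolSum_of_additive_three_polar) :
    ManinAtThreeQuartic :=
  InertBadSignedBranchesInertBadAtThreeManinOfKatoThree.maninAtThreeQuartic_of_katoFactThreePolar hK

/-- **The whole `p = 3` Manin input `ManinAtThree` (v1 stub R₃) from Kato's `p = 3` statement ALONE** — every Kodaira
cell, no Mazur / Abbes–Ullmo / Česnavičius / modularity input (helper p620851 `maninAtThree_of_katoFactThreePolar`);
this is the Manin input of the v5 composition (the printed Manin facts of v2–v4 are dropped from `PrintedInputsAtThree`).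
CONDITIONAL on the named statement. [cite: Kato2004Asterisque, (8.1.3) (p. 180), Thm. 9.7 (p. 189), Thm. 6.6 (1) (p. 163)] -/
theorem maninAtThree_of_katoFact
    (hK : Literature.NumberTheory.EllipticCurves.kato_neron_isIntegral_twistedSymbolSum_of_additive_three_polar) :
    ManinAtThree :=
  InertBadSignedBranchesInertBadAtThreeManinOfKatoThree.maninAtThree_of_katoFactThreePolar hK

/-- **v6: the whole `p = 3` Manin input `ManinAtThree` from the CM-INERT INSTANCES of Kato's statement** (helper
`InertBadSignedBranchesInertBadAtThreeManinOfNeronIntegralCMInert.maninAtThree_of_neronIntegralCMInert`, over the POINTWISE lever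
`InertBadSignedBranchesInertBadAtThreePointwiseKatoLever.not_three_dvd_c_of_neronIntegralAt`). This is the Manin input of the v6
composition. [cite: Kato2004Asterisque, Thm. 9.7 (p. 189)] [cite: Mazur1978, §6 Prop. 6.3 (1) (p. 153)] -/
theorem maninAtThree_of_cmFact (hC : NeronIntegralThreeCMInert) : ManinAtThree :=
  InertBadSignedBranchesInertBadAtThreeManinOfNeronIntegralCMInert.maninAtThree_of_neronIntegralCMInert hC

/-- **v6: F-es-18 ⟹ the v6 stub** (restriction; helper `neronIntegralCMInert_of_katoFact`) — one `_holds` of the named Literature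
statement still closes `stub_neronIntegralThreeCMInert`, so the debt stays shared with route ManinLocalTwoThree's crux 22968.
[cite: Kato2004Asterisque, Thm. 9.7 (p. 189)] -/
theorem neronIntegralThreeCMInert_of_katoFact
    (hK : Literature.NumberTheory.EllipticCurves.kato_neron_isIntegral_twistedSymbolSum_of_additive_three_polar) :
    NeronIntegralThreeCMInert :=
  InertBadSignedBranchesInertBadAtThreeManinOfNeronIntegralCMInert.neronIntegralCMInert_of_katoFact hK

/-! ## The composition (one line over the glue helper) -/

/-- **The crux BY NAME (route `InertBadSignedBranches`' decl, the first sharing route of the item)** from the three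
v6 stubs: printed inputs ⇒ C⁺odd(N,3); the CM-inert instances of Kato's `p = 3` statement ⇒ R₃ (`maninAtThree_of_cmFact`, every
Kodaira cell, through the pointwise lever); then the glue helper's `inertBadAtThree_of_links` with the heart.
[cite: Kato2004Asterisque, Thm. 9.7 (p. 189)] -/
theorem InertBadAtThree_of : PrintedInputsAtThree → NeronIntegralThreeCMInert → HeartAtThree →
    InertBadSignedBranches.InertBadAtThree :=
  fun hI hC hE ↦ InertBadSignedBranchesInertBadAtThreeBedGlue.inertBadAtThree_of_links hI.1
    (nonNullOddIndivisibleHeegnerThree_of_printedInputs hI) (maninAtThree_of_cmFact hC) hE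

/-- **v5's composition, kept: the crux from the printed inputs, the GLOBAL Kato statement F-es-18 and the heart.**
[cite: Kato2004Asterisque, Thm. 9.7 (p. 189)] -/
theorem InertBadAtThree_of_katoFact : PrintedInputsAtThree →
    Literature.NumberTheory.EllipticCurves.kato_neron_isIntegral_twistedSymbolSum_of_additive_three_polar → HeartAtThree →
    InertBadSignedBranches.InertBadAtThree :=
  fun hI hK hE ↦ InertBadAtThree_of hI (neronIntegralThreeCMInert_of_katoFact hK) hE

/-- **The same crux under route `BiquadraticEisensteinDescent`'s decl** (identical body). -/
theorem InertBadAtThree_bed_of : PrintedInputsAtThree → NeronIntegralThreeCMInert → HeartAtThree →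
    BiquadraticEisensteinDescent.InertBadAtThree :=
  InertBadAtThree_of

/-- The composition from the registered stubs (kernel-checked modulo the three `sorry`s, all inside `stub_*`). -/
theorem InertBadAtThree_proof : InertBadSignedBranches.InertBadAtThree :=
  InertBadAtThree_of stub_printedInputsAtThree stub_neronIntegralThreeCMInert stub_heartAtThree

end Summit.BirchSwinnertonDyer.BirchSwinnertonDyer.Cruxes.InertBadAtThree.BedAtThree

end
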